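import Literature.RepresentationTheory.HeisenbergGroup.DoubledDeltaPolarisation
import Literature.RepresentationTheory.HeisenbergGroup.SchrodingerFrobenius
import Literature.NumberTheory.Automorphic.LocalPiSchwartzBruhatFourier
import HarnessLib

/-!
# The Frobenius intertwiner from the doubled Schrödinger model `𝒮(F^κ) ⊗ 𝒮(F^κ)` to the `ℓ_Δ`-model: the diagonal
# integral functional and the explicit formula (a partial Fourier transform in the sum variable)

Topic `RepresentationTheory/HeisenbergGroup`; namespace `Literature.RepresentationTheory.HeisenbergGroup`.  KERNEL ONLY:
one definition with body (`diagIntegral`) and theorems; no record, no named fact, no `sorry`.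

Setting: `F` a non-archimedean local field, `κ`, `ι` finite with `e : κ ⊕ κ ≃ ι`, a Gram matrix `T₀`, the doubled Gram
matrix `T = reindex e e (T₀ ⊕ (−T₀))` (`hT`), `ψ` locally constant, a Haar measure `μ` on `F^κ`.  The doubled Schrödinger
model is `ρ_T = schrodingerSB ⟨·, T ·⟩ ψ` on `𝒮(F^ι)` (tree); `DoubledDeltaPolarisation.lean` gives the isomorphism
`Φ_Δ = deltaHeisenbergEquiv : Heisenberg (polar β_T) ≃* Heisenberg (polar β_Δ)` (`β_Δ = ⟨·, J_Δ ·⟩`, `J_Δ = deltaGram e T₀`)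
sending `ℓ_∇` to translations and `ℓ_Δ` to modulations.

* §1 **`diagIntegral e μ : 𝒮(F^ι) →ₗ[ℂ] ℂ`, `Φ ↦ ∫_u Φ(u ⊔ u) dμ`** (restriction to the diagonal `u ↦ u ⊔ u` is
  Schwartz–Bruhat: `comp_glueDiag_mem_schwartzBruhat`), and its INVARIANCE under `ℓ_Δ`:
  `Λ(ρ_T(deltaW α β, 0) Φ) = Λ(Φ)` (`diagIntegral_schrodingerSB_deltaW`: on the diagonal the phase `β_T(u⊔u, β⊔β)`
  vanishes and `u ↦ u + α` is a Haar translation);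
* §2 the representation `ρ' = ρ_T ∘ Φ_Δ⁻¹` of `Heisenberg (polar β_Δ)` has central character `ψ` and `Λ` is
  `Y_Δ`-invariant for it (`schrodingerSB_comp_deltaHeisenbergEquiv_symm_center`, `diagIntegral_comp_inY`), so the tree's
  Frobenius map `T_Δ = frobeniusToSchrodinger ρ' Λ : 𝒮(F^ι) →ₗ[ℂ] (F^ι → ℂ)` INTERTWINES `ρ_T` with the `ℓ_Δ`-model
  `schrodinger β_Δ ψ` (`deltaFrobenius_apply_schrodingerSB`);
* §3 **the explicit formula** `T_Δ Φ (a ⊔ b) = ∫_u ψ(2 ⟨u, T₀ b⟩) Φ((u + a) ⊔ (u − a)) dμ` (`deltaFrobenius_apply_glue`):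
  a partial Fourier transform in the «sum» variable after the change of variables `(u, a) ↦ (u + a, u − a)`.

That `T_Δ` maps `𝒮(F^ι)` onto `𝒮(F^ι)` bijectively (partial Fourier inversion) is the remaining analytic input of the
change of polarisation [MoeglinVignerasWaldspurger1987, Chap. 2 I.7] and is NOT proved here.

Written for the cell `hodgecm-mathlib` (fan B, rung B-IV, KEY `b4-howe-compact-irreducible`, node E2b of the doubling
proof of `MoeglinVignerasWaldspurger1987.mvw_IV4_rankOne_irreducibleOrZero`).  Nothing about theta lifts is asserted.

## References
* [MoeglinVignerasWaldspurger1987] C. Mœglin, M.-F. Vignéras, J.-L. Waldspurger, LNM 1291 (1987), Chap. 2 I.3, I.7, II.6.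
* [Kudla1994] S. Kudla, Israel J. Math. 87 (1994), §2 (doubled space, diagonal Lagrangian).
-/

set_option autoImplicit false

noncomputable section

open _root_.MeasureTheory

namespace Literature.RepresentationTheory.HeisenbergGroup

open Literature.NumberTheory.Automorphic

variable {F : Type*} [Field F] [ValuativeRel F] [TopologicalSpace F] [IsNonarchimedeanLocalField F]
  {κ ι : Type*} [Fintype κ] [Fintype ι] [DecidableEq κ] [DecidableEq ι]
  (e : κ ⊕ κ ≃ ι) (T₀ : Matrix κ κ F) {T : Matrix ι ι F}
  (hT : T = Matrix.reindex e e (Matrix.fromBlocks T₀ 0 0 (-T₀)))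
  {ψ : AddChar F Circle} (hl : IsLocallyConstant (⇑ψ : F → Circle))
  (hb : ∀ y : ι → F, Continuous fun u : ι → F => Matrix.toLinearMap₂' F T u y)
  [MeasurableSpace (κ → F)] [BorelSpace (κ → F)] (μ : Measure (κ → F))

/-! ## §1 The diagonal integral functional -/

omit [Fintype κ] [Fintype ι] [DecidableEq κ] [DecidableEq ι] [MeasurableSpace (κ → F)] [BorelSpace (κ → F)] in
/-- restriction of a Schwartz–Bruhat function to the diagonal `u ↦ u ⊔ u` is Schwartz–Bruhat. [cite: Kudla1994, §2] -/
theorem comp_glueDiag_mem_schwartzBruhat {Φ : (ι → F) → ℂ} (hΦ : Φ ∈ SchwartzBruhat (ι → F)) :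
    (fun u : κ → F => Φ (glue e u u)) ∈ SchwartzBruhat (κ → F) := by
  haveI : T2Space F := (Literature.NumberTheory.GaloisRepresentations.IsNonarchimedeanLocalField.isLocalField F).toT2Space
  obtain ⟨hlc, hcs⟩ := mem_schwartzBruhat_iff.1 hΦ
  have hd : Continuous fun u : κ → F => glue e u u := (continuous_glue e).comp (continuous_id.prodMk continuous_id)
  refine mem_schwartzBruhat_iff.2 ⟨hlc.comp_continuous hd, ?_⟩
  -- the support is contained in `resL '' tsupport Φ`, a compact set
  refine HasCompactSupport.intro' (hcs.image (continuous_resL e)) (hcs.image (continuous_resL e)).isClosed fun u hu => ?_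
  by_contra hne
  exact hu ⟨glue e u u, subset_tsupport _ hne, resL_glue e u u⟩

/-- **the diagonal integral** `Λ(Φ) = ∫_u Φ(u ⊔ u) dμ` on `𝒮(F^ι)`, `ι ≃ κ ⊕ κ`. [cite: MoeglinVignerasWaldspurger1987, Chap. 2 I.7] -/
def diagIntegral [IsFiniteMeasureOnCompacts μ] : SchwartzBruhat (ι → F) →ₗ[ℂ] ℂ where
  toFun Φ := ∫ u, (Φ : (ι → F) → ℂ) (glue e u u) ∂μ
  map_add' Φ Φ' := by
    simp only [Submodule.coe_add, Pi.add_apply]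
    exact integral_add (integrable_of_mem_schwartzBruhat μ (comp_glueDiag_mem_schwartzBruhat e Φ.2))
      (integrable_of_mem_schwartzBruhat μ (comp_glueDiag_mem_schwartzBruhat e Φ'.2))
  map_smul' c Φ := by
    simp only [Submodule.coe_smul, Pi.smul_apply, smul_eq_mul, RingHom.id_apply]
    exact integral_const_mul c _

omit [Fintype κ] [Fintype ι] [DecidableEq κ] [DecidableEq ι] in
/-- formula. [cite: MoeglinVignerasWaldspurger1987, Chap. 2 I.7] -/
theorem diagIntegral_apply [IsFiniteMeasureOnCompacts μ] (Φ : SchwartzBruhat (ι → F)) :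
    diagIntegral e μ Φ = ∫ u, (Φ : (ι → F) → ℂ) (glue e u u) ∂μ := rfl

omit [MeasurableSpace (κ → F)] [BorelSpace (κ → F)] in
include hT in
/-- **`ρ_T` of an element of `ℓ_Δ` on the diagonal**: `(ρ_T((α ⊔ α, β ⊔ β), t) Φ)(u ⊔ u) = ψ(t) Φ((u + α) ⊔ (u + α))` —
the phase `β_T(u ⊔ u, β ⊔ β)` vanishes. [cite: Kudla1994, §2] -/
theorem schrodingerSB_deltaW_apply_glueDiag (α β : κ → F) (t : F) (Φ : SchwartzBruhat (ι → F)) (u : κ → F) :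
    ((schrodingerSB (Matrix.toLinearMap₂' F T) ψ hl hb ⟨deltaW e α β, t⟩ Φ : SchwartzBruhat (ι → F)) : (ι → F) → ℂ)
        (glue e u u) = ((ψ t : Circle) : ℂ) * (Φ : (ι → F) → ℂ) (glue e (u + α) (u + α)) := by
  rw [schrodingerSB_apply]
  simp only [deltaW_snd, deltaW_fst, toLinearMap₂'_delta_delta e T₀ hT, add_zero, glue_add]

include hT in
/-- **`Λ` is `ℓ_Δ`-invariant**: `Λ(ρ_T((α ⊔ α, β ⊔ β), 0) Φ) = Λ(Φ)` (`μ` right-invariant). [cite: MoeglinVignerasWaldspurger1987, Chap. 2 I.7] -/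
theorem diagIntegral_schrodingerSB_deltaW [IsFiniteMeasureOnCompacts μ] [μ.IsAddRightInvariant] (α β : κ → F)
    (Φ : SchwartzBruhat (ι → F)) :
    diagIntegral e μ (schrodingerSB (Matrix.toLinearMap₂' F T) ψ hl hb ⟨deltaW e α β, 0⟩ Φ) = diagIntegral e μ Φ := by
  rw [diagIntegral_apply, diagIntegral_apply]
  simp only [schrodingerSB_deltaW_apply_glueDiag e T₀ hT hl hb, AddChar.map_zero_eq_one, Circle.coe_one, one_mul]
  exact integral_add_right_eq_self (fun u => (Φ : (ι → F) → ℂ) (glue e u u)) α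

/-! ## §2 The transported representation of `Heisenberg (polar β_Δ)` and the Frobenius map -/

section Transported

variable [Invertible (2 : F)]

omit [ValuativeRel F] [TopologicalSpace F] [IsNonarchimedeanLocalField F] [MeasurableSpace (κ → F)] [BorelSpace (κ → F)] in
include hT in
/-- the inverse of `deltaHeisenbergEquiv` on a modulation element: `Φ_Δ⁻¹((0, q), 0) = (deltaW q_L q_R, 0)`.
[cite: MoeglinVignerasWaldspurger1987, Chap. 2 I.7] -/
theorem deltaHeisenbergEquiv_symm_inY (q : ι → F) :
    (deltaHeisenbergEquiv e T₀ hT).symm (inY (Matrix.toLinearMap₂' F (deltaGram e T₀)) q) =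
      ⟨deltaW e (resL e q) (resR e q), 0⟩ := by
  apply (deltaHeisenbergEquiv e T₀ hT).injective
  rw [MulEquiv.apply_symm_apply, deltaHeisenbergEquiv_deltaW, glue_resL_resR]
  rfl

omit [ValuativeRel F] [TopologicalSpace F] [IsNonarchimedeanLocalField F] [MeasurableSpace (κ → F)] [BorelSpace (κ → F)] in
include hT in
/-- the inverse of `deltaHeisenbergEquiv` on a translation element: `Φ_Δ⁻¹((p, 0), 0) = (nablaW p_L p_R, 0)`.
[cite: MoeglinVignerasWaldspurger1987, Chap. 2 I.7] -/
theorem deltaHeisenbergEquiv_symm_inX (p : ι → F) :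
    (deltaHeisenbergEquiv e T₀ hT).symm (inX (Matrix.toLinearMap₂' F (deltaGram e T₀)) p) =
      ⟨nablaW e (resL e p) (resR e p), 0⟩ := by
  apply (deltaHeisenbergEquiv e T₀ hT).injective
  rw [MulEquiv.apply_symm_apply, deltaHeisenbergEquiv_nablaW, glue_resL_resR]
  rfl

omit [ValuativeRel F] [TopologicalSpace F] [IsNonarchimedeanLocalField F] [MeasurableSpace (κ → F)] [BorelSpace (κ → F)] in
include hT in
/-- the inverse of `deltaHeisenbergEquiv` on the centre. [cite: MoeglinVignerasWaldspurger1987, Chap. 2 I.7] -/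
theorem deltaHeisenbergEquiv_symm_center (t : F) :
    (deltaHeisenbergEquiv e T₀ hT).symm ⟨(0, 0), t⟩ = ⟨0, t⟩ := by
  apply (deltaHeisenbergEquiv e T₀ hT).injective
  rw [MulEquiv.apply_symm_apply, deltaHeisenbergEquiv_center]
  rfl

omit [MeasurableSpace (κ → F)] [BorelSpace (κ → F)] in
include hT in
/-- **`ρ' = ρ_T ∘ Φ_Δ⁻¹` has central character `ψ`.** [cite: MoeglinVignerasWaldspurger1987, Chap. 2 I.2] -/
theorem schrodingerSB_comp_deltaHeisenbergEquiv_symm_center (t : F) (Φ : SchwartzBruhat (ι → F)) :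
    ((schrodingerSB (Matrix.toLinearMap₂' F T) ψ hl hb).comp (deltaHeisenbergEquiv e T₀ hT).symm.toMonoidHom :
        Representation ℂ _ (SchwartzBruhat (ι → F))) ⟨(0, 0), t⟩ Φ = ((ψ t : Circle) : ℂ) • Φ := by
  rw [MonoidHom.comp_apply, MulEquiv.coe_toMonoidHom, deltaHeisenbergEquiv_symm_center e T₀ hT]
  have h : (⟨0, t⟩ : Heisenberg (polar (Matrix.toLinearMap₂' F T))) =
      Heisenberg.ofCenter (polar (Matrix.toLinearMap₂' F T)) (Multiplicative.ofAdd t) := by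
    apply Heisenberg.ext <;> simp
  rw [h, schrodingerSB_ofCenter]

include hT in
/-- **`Λ` is `Y_Δ`-invariant for `ρ'`.** [cite: MoeglinVignerasWaldspurger1987, Chap. 2 I.7] -/
theorem diagIntegral_comp_inY [IsFiniteMeasureOnCompacts μ] [μ.IsAddRightInvariant] (q : ι → F)
    (Φ : SchwartzBruhat (ι → F)) :
    diagIntegral e μ (((schrodingerSB (Matrix.toLinearMap₂' F T) ψ hl hb).comp
        (deltaHeisenbergEquiv e T₀ hT).symm.toMonoidHom : Representation ℂ _ (SchwartzBruhat (ι → F)))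
          (inY (Matrix.toLinearMap₂' F (deltaGram e T₀)) q) Φ) = diagIntegral e μ Φ := by
  rw [MonoidHom.comp_apply, MulEquiv.coe_toMonoidHom, deltaHeisenbergEquiv_symm_inY e T₀ hT]
  exact diagIntegral_schrodingerSB_deltaW e T₀ hT hl hb μ _ _ Φ

include hT in
/-- **the Frobenius map `T_Δ` intertwines `ρ_T` with the `ℓ_Δ`-Schrödinger model**:
`T_Δ (ρ_T(h) Φ) = schrodinger β_Δ ψ (Φ_Δ h) (T_Δ Φ)`. [cite: MoeglinVignerasWaldspurger1987, Chap. 2 I.7] -/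
theorem deltaFrobenius_apply_schrodingerSB [IsFiniteMeasureOnCompacts μ] [μ.IsAddRightInvariant]
    (h : Heisenberg (polar (Matrix.toLinearMap₂' F T))) (Φ : SchwartzBruhat (ι → F)) :
    frobeniusToSchrodinger ((schrodingerSB (Matrix.toLinearMap₂' F T) ψ hl hb).comp
        (deltaHeisenbergEquiv e T₀ hT).symm.toMonoidHom : Representation ℂ _ (SchwartzBruhat (ι → F))) (diagIntegral e μ)
        (schrodingerSB (Matrix.toLinearMap₂' F T) ψ hl hb h Φ) =
      schrodinger (Matrix.toLinearMap₂' F (deltaGram e T₀)) ψ (deltaHeisenbergEquiv e T₀ hT h)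
        (frobeniusToSchrodinger ((schrodingerSB (Matrix.toLinearMap₂' F T) ψ hl hb).comp
          (deltaHeisenbergEquiv e T₀ hT).symm.toMonoidHom : Representation ℂ _ (SchwartzBruhat (ι → F)))
          (diagIntegral e μ) Φ) := by
  have key := frobeniusToSchrodinger_apply_rep ψ
    ((schrodingerSB (Matrix.toLinearMap₂' F T) ψ hl hb).comp (deltaHeisenbergEquiv e T₀ hT).symm.toMonoidHom :
      Representation ℂ _ (SchwartzBruhat (ι → F)))
    (diagIntegral e μ) (schrodingerSB_comp_deltaHeisenbergEquiv_symm_center e T₀ hT hl hb)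
    (diagIntegral_comp_inY e T₀ hT hl hb μ) (deltaHeisenbergEquiv e T₀ hT h) Φ
  rw [MonoidHom.comp_apply, MulEquiv.coe_toMonoidHom, MulEquiv.symm_apply_apply] at key
  exact key

/-! ## §3 The explicit formula -/

omit [MeasurableSpace (κ → F)] [BorelSpace (κ → F)] [Invertible (2 : F)] in
include hT in
/-- **`ρ_T` of an element of `ℓ_∇` on the diagonal**: `(ρ_T((a ⊔ −a, b ⊔ −b), 0) Φ)(u ⊔ u) = ψ(2⟨u, T₀ b⟩) Φ((u+a) ⊔ (u−a))`.
[cite: Kudla1994, §2] -/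
theorem schrodingerSB_nablaW_apply_glueDiag (a b : κ → F) (Φ : SchwartzBruhat (ι → F)) (u : κ → F) :
    ((schrodingerSB (Matrix.toLinearMap₂' F T) ψ hl hb ⟨nablaW e a b, 0⟩ Φ : SchwartzBruhat (ι → F)) : (ι → F) → ℂ)
        (glue e u u) =
      ((ψ (2 * Matrix.toLinearMap₂' F T₀ u b) : Circle) : ℂ) * (Φ : (ι → F) → ℂ) (glue e (u + a) (u - a)) := by
  rw [schrodingerSB_apply]
  simp only [nablaW_snd, nablaW_fst, toLinearMap₂'_delta_nabla e T₀ hT, zero_add, glue_add, ← sub_eq_add_neg]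

include hT in
/-- **the formula**: `T_Δ Φ (a ⊔ b) = ∫_u ψ(2⟨u, T₀ b⟩) Φ((u + a) ⊔ (u − a)) dμ`. [cite: MoeglinVignerasWaldspurger1987, Chap. 2 I.7] -/
theorem deltaFrobenius_apply_glue [IsFiniteMeasureOnCompacts μ] (a b : κ → F) (Φ : SchwartzBruhat (ι → F)) :
    frobeniusToSchrodinger ((schrodingerSB (Matrix.toLinearMap₂' F T) ψ hl hb).comp
        (deltaHeisenbergEquiv e T₀ hT).symm.toMonoidHom : Representation ℂ _ (SchwartzBruhat (ι → F))) (diagIntegral e μ) Φ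
        (glue e a b) =
      ∫ u, ((ψ (2 * Matrix.toLinearMap₂' F T₀ u b) : Circle) : ℂ) * (Φ : (ι → F) → ℂ) (glue e (u + a) (u - a)) ∂μ := by
  rw [frobeniusToSchrodinger_apply, MonoidHom.comp_apply, MulEquiv.coe_toMonoidHom, deltaHeisenbergEquiv_symm_inX e T₀ hT,
    resL_glue, resR_glue, diagIntegral_apply]
  simp only [schrodingerSB_nablaW_apply_glueDiag e T₀ hT hl hb]

end Transported

end Literature.RepresentationTheory.HeisenbergGroup

end
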